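import Summits.BirchSwinnertonDyer.Rank1Residual.Additive.GordBranchPAdicGrossZagierConverse
import Summits.BirchSwinnertonDyer.Rank1Residual.Additive.GordBranchPAdicGrossZagierOdd
import Summits.BirchSwinnertonDyer.Rank1Residual.Additive.SemistableTwistTowerThree
import HarnessLib

/-!
# T-O7c (i), CONVERSE on the defect-2 rows, ODD branch (`p ≡ 3 (mod 4)`): given the branch main
# conjecture (p07's LOWER `ChiBranchLowerDivisibilityOddAt` ∧ Kato's UPPER, published) and Delbourgo's
# (B)-clauses, `BSD(E,p)` in rank one IMPLIES the typed odd-branch `p`-adic Gross–Zagier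
# `BranchPAdicGrossZagierOddAt W p Dh` — so the typed input conjectures NOTHING beyond `BSD_p` + the
# branch IMC (cell `b2b-bsdres`, team n1011, seat p01 GEN 2, OWNERS row T-O7c; odd twin of
# `GordBranchPAdicGrossZagierConverse.lean`, sequel of `GordBranchPAdicGrossZagierOdd.lean`)

HONEST FRAMING (cell `b2b-bsdres`, run/shared/lean/b2b/bsd-rank1-residual/, verbatim in every
file): prove what is provable now; shrink each hard class to its core with data; no claim beyond
stated classes. Research routes; census output = EVIDENCE / conjecture items, never a Literature
fact; RESIDUAL-MAP marks change only by signed lines. §I O7 stays OPEN; X4♯(G-ord) stays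
CONSTRUCTION-SHAPED; nothing is booked; no label changes. COVERAGE (stated first, referee 1
proviso): the DEFECT-2 rows `E = V ⊗ χ_{−p}`, `V = E♭` GOOD ORDINARY at `p ≡ 3 (mod 4)` (odd branch
`ω^{(p−1)/2} = χ_{−p}`, MINUS modular symbols, imaginary period), `ρ̄_{E,p}` SURJECTIVE, `E` of
analytic rank `1`, non-anomalous (Delbourgo's `ℓ_p = 1`); `p = 3` IS INCLUDED in the core theorem and
in the class form (the `p`-adic tower of `V` comes from surj(p) ALONE by lit-kato's proved good-ordinary
case of Wuthrich 2014 Lemma 20, `forall_hasSurjectiveModNGaloisRep_pow_of_goodOrdinary_of_surj`, at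
every odd `p` — no Serre `p ≥ 5`); the (B)-clauses `LeadingTermClauses W p Dh` are a HYPOTHESIS here
(the output of A175 at `p ≥ 7`, of p16's `Delbourgo2002.mainTheorem_three` at `p = 3`). NO
definition, NO Literature fact minted, NO `_holds`; theorems only. The `Λ`-algebra is gen 1's
`exists_unit_coeff_one_eq_of_lower_of_upper` (IMPORTED, not re-proved).

## What (the loop closes on the odd branch)

`GordBranchPAdicGrossZagierOdd.lean` proved `ChiBranchLowerDivisibilityOddAt ∧
BranchPAdicGrossZagierOddAt ⟹ CycLowerBoundAt ⟹ MissingLowerBoundAt` (with A175 + rider). HERE the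
converse:

* §1 `branchPAdicGrossZagierOddAt_of_bsdp_of_chiBranchLowerOdd_of_kato`: `BSDp W p` (Miller) ∧ the
  (B)-clauses for `Dh` ∧ the Schneider rider ∧ `ℓ_p = 1` ∧ p07's `ChiBranchLowerDivisibilityOddAt W p`
  ∧ Kato 2004 Thm. 17.4 (3) on the component (`hK`, PUBLISHED, odd clause of additive-p2's
  `isTorsion_and_exists_iota_eq_branch_of_katoComponent`) ∧ `Surj W p` ⟹
  `BranchPAdicGrossZagierOddAt W p Dh` in analytic rank `1`, at EVERY `p ≡ 3 (mod 4)`. Proof: (B) gives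
  `[T¹]fE·log_p γ·#T² = u_B·#Ш[p^∞]·Reg_p·Tam` and `fE(0) = 0`; lower ∧ upper give
  `ϖ[T¹]B⁻ = h(0)⁻¹[T¹]fE`; `BSD(E,p)` says `#Ш_an/#Ш[p^∞] ∈ ℤ_p^×`; so
  `ϖ·[T¹]B⁻·log_p γ = (h(0)⁻¹·u_B·#Ш[p^∞]/#Ш_an)·q·Reg_p` with `q = #Ш_an·Tam/#T²`,
  `L'(E,1) = q·Ω_E·Reg_∞`. NO Birch / Pal / GZK binder is used.
* §2 class forms on X4♯(G-ord) ∩ `I₀*` ∩ surj, `p ≡ 3 (mod 4)` inside the predicate, every such `p`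
  (`p = 3` included).
So on X4♯(G-ord) ∩ `I₀*` ∩ surj, `p ≡ 3 (mod 4)`, rank one, GIVEN the branch IMC (our LOWER conjecture
+ Kato) and the (B)-clauses: the typed odd-branch `p`-adic Gross–Zagier is EQUIVALENT to the `p`-part
of BSD — it is EXACTLY the missing analytic input, not a stronger conjecture.

References: [Delbourgo2002] Thm. (B) (p. 40); [Kato2004Asterisque] Thm. 17.4 (3); [Wuthrich2014]
Lemma 20; [Miller2011LMS] Def. 1.1; [MazurTateTeitelbaum1986Invent] §I.13–I.14; [GreenbergLNM1716] §5.
-/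

noncomputable section

open scoped Classical MatrixGroups ModularForm NumberField

open CongruenceSubgroup WeierstrassCurve NumberField Literature.NumberTheory.EllipticCurves
  Literature.NumberTheory.EllipticCurves.ModularForms
  Literature.NumberTheory.EllipticCurves.Rank1Residual
  Literature.NumberTheory.EllipticCurves.Rank1Residual.Typed
  Literature.NumberTheory.EllipticCurves.Delbourgo2002
  Literature.NumberTheory.GaloisRepresentations
  IsDedekindDomain

namespace Summit.BirchSwinnertonDyer.Rank1Residual.Additive

variable (W : WeierstrassCurve ℚ) [W.IsElliptic] [W.IsGloballyMinimal] (p : ℕ) [hp : Fact p.Prime]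

/-! ### §1 The converse on the odd branch: `BSD(E,p)` ∧ branch IMC ∧ (B)-clauses ⟹ the typed input -/

omit [W.IsGloballyMinimal] in
variable {W p} in
/-- **CONVERSE (defect 2, ODD branch, rank one, every `p ≡ 3 (mod 4)` incl. `3`).** Let `p` be a prime
(`p ≡ 3 (mod 4)` is inside the conclusion's binders), `ρ̄_{E,p}` surjective, `E` potentially good
ordinary of type (G) (`TypeGOrd`), of analytic rank `1`, non-anomalous, and `Dh` a height datum with
Delbourgo's (B)-clauses and `Reg_p(E,Dh) ≠ 0`. IF `BSD(E,p)` holds (Miller), p07's LOWER odd-branch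
input `ChiBranchLowerDivisibilityOddAt W p` holds and Kato's component divisibility (`hK`, Kato 2004
Thm. 17.4 (3), PUBLISHED) is granted, THEN `BranchPAdicGrossZagierOddAt W p Dh`: for every admissible
`(V, C, f, ϖ⁻)` (`V` good ordinary, `C • V^{(−p)} = W`, `ϖ⁻·|Ω⁻(V)| = Ω⁻_f`),
`ϖ⁻·[T¹]B⁻·log_p γ = u·q·Reg_p(E,Dh)` with `u ∈ ℤ_p^×`, `q = #Ш_an·Tam/#T²`. The `p`-adic tower of `V`
(Kato's image hypothesis) comes from surj(p) alone (`V` good ordinary: Wuthrich 2014 Lemma 20, proved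
in the tree), so NO `p ≥ 5`. With `GordBranchPAdicGrossZagierOdd.lean` (forward direction) this makes
the typed odd-branch `p`-adic Gross–Zagier EQUIVALENT to `BSD_p` on these rows modulo the branch IMC
and the (B)-clauses — nothing stronger is conjectured. Binders: `hK` (published), modularity `hmod`
(for `L'(E,1) ≠ 0`); NO Birch/Pal/GZK. [cite: Delbourgo2002, Theorem (B) (p. 40)]
[cite: Kato2004Asterisque, Thm. 17.4 (3) (p. 273)] [cite: Wuthrich2014, Lemma 20 (p. 399)]
[cite: Miller2011LMS, Def. 1.1] [cite: GreenbergLNM1716, §5 (PDF p. 143)] -/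
theorem branchPAdicGrossZagierOddAt_of_bsdp_of_chiBranchLowerOdd_of_kato
    (hK : Kato2004.charIdeal_dvd_padicLFunctionBranch_component_of_surjective)
    (hmod : hasEntireLFunction_rat) {Dh : PAdicHeightData W p}
    (hB : LeadingTermClauses W p Dh) (hS : SchneiderConjecture Dh) (hna : ReductionNonAnomalous W p)
    (hG : TypeGOrd W p) (hsurj : Surj W p) (hr : W.analyticRank = 1) (hbsd : BSDp W p)
    (hdiv : ChiBranchLowerDivisibilityOddAt W p) : BranchPAdicGrossZagierOddAt W p Dh := by
  intro V _ _ N _ f hp4 hVW hord hf ϖ hϖ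
  have hpP : p.Prime := hp.out
  have hp2 : p ≠ 2 := by omega
  have hodd : ¬ Even (p / 2) := by
    rw [Nat.not_even_iff_odd]
    exact ⟨p / 4, by omega⟩
  obtain ⟨hrank, hfinp, s, hs, hvs⟩ := hbsd
  have hmw : W.mordellWeilRank = 1 := by rw [hrank, hr]
  obtain ⟨C, hC⟩ := hVW
  have hps : ((-1 : ℚ) ^ (p / 2) * (p : ℚ)) = -(p : ℚ) := by
    rw [pStar_eq_of_mod_four p (Or.inr hp4), if_neg (by omega)]
  have hC' : C • V.quadraticTwist ((-1 : ℚ) ^ (p / 2) * p) = W := by rw [hps]; exact hC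
  -- the cyclotomic setting, a dual datum, a generator of `char_Λ X(E/ℚ_∞)`
  obtain ⟨κ, hκ, γ, hγ, hγ'⟩ := exists_isCyclotomic_isTopGenerator_isCyclotomicVariable_holds p
  obtain ⟨D⟩ := W.nonempty_selmerDualData_holds κ γ hγ
  haveI : Module.Finite (IwasawaAlgebra p) D.X := D.module_finite_holds hγ
  haveI : (Literature.NumberTheory.EllipticCurves.Module.charIdeal (IwasawaAlgebra p) D.X).IsPrincipal :=
    charIdeal_isPrincipal_holds p D.X
  obtain ⟨fE, hchar⟩ := Submodule.IsPrincipal.principal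
    (Literature.NumberTheory.EllipticCurves.Module.charIdeal (IwasawaAlgebra p) D.X)
  have hchar' : D.charIdeal = Ideal.span {fE} := hchar
  -- UPPER (Kato on the component, full series, odd clause): `ι g = C(u·ϖ)·B⁻` for some `g ∈ char`;
  -- the tower of `V` from surj(p) of `W` (twist transport + Wuthrich Lemma 20, good ordinary case)
  have hsV : Surj V p := (surj_iff_of_model_twist V p (pStar_ne_zero p) ⟨C, hC'⟩).mp hsurj
  have hsurjV : ∀ n : ℕ, V.HasSurjectiveModNGaloisRep (p ^ n : ℕ) :=
    V.forall_hasSurjectiveModNGaloisRep_pow_of_goodOrdinary_of_surj p hp2 hord.1 hord.2 hsV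
  have hϖ' : (if Even (p / 2) then (ϖ : ℝ) * V.realPeriodRat = plusPeriod f
      else (ϖ : ℝ) * V.imaginaryPeriodRat = minusPeriod f) := by
    rw [if_neg hodd]; exact hϖ
  obtain ⟨hXt, g, hg, u, hι⟩ := isTorsion_and_exists_iota_eq_branch_of_katoComponent W p hK
    (padicValRat_j_nonneg_of_typeGOrd W p hG) hp2 V ⟨C, hC'⟩ (Or.inl hord) hsurjV hκ hγ hγ' hf D ϖ hϖ'
  rw [if_neg hodd] at hι
  set B := padicLFunctionMinusBranch f ((unitRoot V p : ℤ_[p]) : ℚ_[p]) (p / 2) with hB_def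
  set G : PowerSeries ℚ_[p] := PowerSeries.C ((ϖ : ℚ) : ℚ_[p]) * B with hG_def
  have hgspan : g ∈ Ideal.span {fE} := by rw [← hchar']; exact hg
  obtain ⟨k, hk⟩ := Ideal.mem_span_singleton'.mp hgspan
  have hup : iwasawaToPowerSeries p (k * fE) = PowerSeries.C ((u : ℤ_[p]) : ℚ_[p]) * G := by
    rw [hk, hι, hG_def, ← mul_assoc, ← map_mul]
  -- LOWER (p07's typed odd-branch input): `ι fE = ι h · G`
  obtain ⟨h, hlow⟩ := hdiv V hp4 ⟨C, hC⟩ hord hκ hγ hγ' hf D ϖ hϖ fE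
    (by rw [hchar']; exact Ideal.mem_span_singleton_self fE)
  -- (B): `fE(0) = 0` and the exact leading term (ℓ = 1)
  have hord1 : (W.mordellWeilRank : ℕ∞) ≤ fE.order := (hB κ γ hκ hγ hγ' D hXt fE hchar').1
  have h0 : PowerSeries.constantCoeff fE = 0 := by
    rw [← PowerSeries.coeff_zero_eq_constantCoeff_apply]
    refine PowerSeries.coeff_of_lt_order 0 ?_
    rw [hmw, Nat.cast_one] at hord1
    exact lt_of_lt_of_le (by exact_mod_cast zero_lt_one) hord1
  obtain ⟨uB, hBeq⟩ := hB.leadingCoeff_of_nonAnomalous hκ hγ hγ' D hXt hchar' hS hfinp hna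
  rw [hmw, pow_one] at hBeq
  -- positivity / non-vanishing
  have hT0 : W.torsionOrder ≠ 0 := (W.torsionOrder_pos_holds).ne'
  have hTQ : (W.torsionOrder : ℚ_[p]) ≠ 0 := by exact_mod_cast hT0
  have hT2Q : (W.torsionOrder : ℚ_[p]) ^ 2 ≠ 0 := pow_ne_zero 2 hTQ
  have hPpos : 0 < W.tamagawaProduct := W.tamagawaProduct_pos_holds
  have hCQ : (W.tamagawaProduct : ℚ_[p]) ≠ 0 := by exact_mod_cast hPpos.ne'
  have hShp0 : (Nat.card (AddCommGroup.primaryComponent W.sha p) : ℚ_[p]) ≠ 0 := by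
    exact_mod_cast Nat.card_pos.ne'
  have huB0 : ((uB : ℤ_[p]) : ℚ_[p]) ≠ 0 := coe_units_ne_zero p uB
  have hRegp : padicRegulator Dh ≠ 0 := hS
  have hlog : padicLog p (cyclotomicGenerator p : ℚ_[p]) ≠ 0 := by
    obtain ⟨uγ, huγ⟩ := exists_unit_padicLog_cyclotomicGenerator p hp2
    rw [huγ]
    exact mul_ne_zero (Nat.cast_ne_zero.mpr hpP.ne_zero) (coe_units_ne_zero p uγ)
  have h1 : PowerSeries.coeff 1 fE ≠ 0 := by
    intro hz
    rw [hz, PadicInt.coe_zero, zero_mul, zero_mul] at hBeq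
    exact mul_ne_zero huB0 (mul_ne_zero (mul_ne_zero hShp0 hRegp) hCQ) hBeq.symm
  -- gen 1 §1: `[T¹] G = w · [T¹] fE`, `w ∈ ℤ_p^×`
  obtain ⟨w, hw⟩ := exists_unit_coeff_one_eq_of_lower_of_upper p hlow hup h0 h1
  -- the rational `q` (definition of the analytic Ш)
  have hΩpos : 0 < W.realPeriodRat := W.realPeriodRat_pos_holds
  have hRegpos : 0 < W.regulator := regulator_pos_holds W
  set q : ℚ := s * (W.tamagawaProduct : ℚ) / (W.torsionOrder : ℚ) ^ 2 with hq_def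
  have hlead : W.leadingLCoeff = (q : ℂ) * (W.realPeriodRat : ℂ) * (W.regulator : ℂ) := by
    have hΩC : (W.realPeriodRat : ℂ) ≠ 0 := by exact_mod_cast hΩpos.ne'
    have hRegC : (W.regulator : ℂ) ≠ 0 := by exact_mod_cast hRegpos.ne'
    have hTC : (W.torsionOrder : ℂ) ≠ 0 := by exact_mod_cast hT0
    have hPC : (W.tamagawaProduct : ℂ) ≠ 0 := by exact_mod_cast hPpos.ne'
    have h := hs
    rw [shaAn_def] at h
    rw [hq_def]
    push_cast
    rw [div_eq_iff (mul_ne_zero (mul_ne_zero hΩC hPC) hRegC)] at h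
    field_simp
    linear_combination h
  have hL0 : W.leadingLCoeff ≠ 0 := W.leadingLCoeff_ne_zero_holds (hmod W)
  have hs0 : s ≠ 0 := by
    intro hz
    apply hL0
    rw [hlead, hq_def, hz]
    simp
  -- the unit `#Ш[p^∞] / #Ш_an` — this is where `BSD(E,p)` enters
  have hsQ : ((s : ℚ) : ℚ_[p]) ≠ 0 := by exact_mod_cast hs0
  set t : ℚ_[p] := (Nat.card (AddCommGroup.primaryComponent W.sha p) : ℚ_[p]) / ((s : ℚ) : ℚ_[p])
    with ht_def
  have hnorm : ‖t‖ = 1 := by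
    have hnS : ‖(Nat.card (AddCommGroup.primaryComponent W.sha p) : ℚ_[p])‖ = ‖((s : ℚ) : ℚ_[p])‖ := by
      rw [Padic.norm_eq_zpow_neg_valuation hShp0, Padic.norm_eq_zpow_neg_valuation hsQ,
        Padic.valuation_natCast, Padic.valuation_ratCast, hvs]
    rw [ht_def, norm_div, hnS, div_self (norm_ne_zero_iff.mpr hsQ)]
  obtain ⟨wS, hwS⟩ := exists_unit_coe_eq_of_norm_eq_one p hnorm
  -- assemble
  refine ⟨w * uB * wS, q, hlead, ?_⟩
  have hG1 : PowerSeries.coeff 1 G = ((ϖ : ℚ) : ℚ_[p]) * PowerSeries.coeff 1 B := by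
    rw [hG_def, PowerSeries.coeff_C_mul]
  have hf1 : ((PowerSeries.coeff 1 fE : ℤ_[p]) : ℚ_[p]) =
      ((uB : ℤ_[p]) : ℚ_[p]) *
          ((Nat.card (AddCommGroup.primaryComponent W.sha p) : ℚ_[p]) * padicRegulator Dh *
            W.tamagawaProduct) /
        (padicLog p (cyclotomicGenerator p : ℚ_[p]) * (W.torsionOrder : ℚ_[p]) ^ 2) := by
    rw [eq_div_iff (mul_ne_zero hlog hT2Q), ← hBeq]
    ring
  rw [hmw, pow_one, ← hG1, hw, Units.val_mul, Units.val_mul, PadicInt.coe_mul, PadicInt.coe_mul, hwS,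
    ht_def, hq_def, hf1]
  push_cast
  field_simp

/-! ### §2 Class forms: X4♯(G-ord) ∩ `I₀*` ∩ {`ρ̄_{E,p}` onto}, `p ≡ 3 (mod 4)`, rank one -/

omit [W.IsGloballyMinimal] in
variable {W p} in
/-- **Class form: X4♯(G-ord) ∩ `I₀*` ∩ {`ρ̄_{E,p}` onto}, `p ≡ 3 (mod 4)` inside the predicate, EVERY
such `p` (`p = 3` included), `r_an = 1`, non-anomalous.** For every height datum with Delbourgo's
(B)-clauses and the rider: `BSD(E,p)` ∧ p07's LOWER odd-branch input ∧ Kato (published) ⟹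
`BranchPAdicGrossZagierOddAt W p Dh` — the converse of
`ClassX4Gord.missingLowerBoundAt_rankOne_of_chiBranchLowerOdd_of_branchPAdicGrossZagierOdd` (which
needs A175, hence `p ≥ 7`, or p16's `mainTheorem_three` at `p = 3` to PRODUCE the clauses; here they
are a hypothesis). X4♯(G-ord) stays CONSTRUCTION-SHAPED; nothing booked.
[cite: Delbourgo2002, Theorem (B) (p. 40)] [cite: Kato2004Asterisque, Thm. 17.4 (3) (p. 273)]
[cite: Miller2011LMS, Def. 1.1] -/
theorem ClassX4Gord.branchPAdicGrossZagierOddAt_of_bsdp_of_chiBranchLowerOdd_of_kato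
    (hK : Kato2004.charIdeal_dvd_padicLFunctionBranch_component_of_surjective)
    (hmod : hasEntireLFunction_rat) (hX : ClassX4Gord W p) (hsurj : Surj W p)
    (hr : W.analyticRank = 1) (hna : ReductionNonAnomalous W p) (hbsd : BSDp W p)
    (hdiv : ChiBranchLowerDivisibilityOddAt W p) {Dh : PAdicHeightData W p}
    (hB : LeadingTermClauses W p Dh) (hS : SchneiderConjecture Dh) :
    BranchPAdicGrossZagierOddAt W p Dh :=
  Additive.branchPAdicGrossZagierOddAt_of_bsdp_of_chiBranchLowerOdd_of_kato hK hmod hB hS hna hX.typeGOrd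
    hsurj hr hbsd hdiv

omit [W.IsGloballyMinimal] in
variable {W p} in
/-- **Class form over the HALF-EIGEN reading of Kato** (`Wuthrich2014.kato_halfEigenCharIdeal_dvd_…`,
the binder used by n1011-p12's T-O7K3 at `p = 3` and by p07's T-O7KM): same conclusion, the component
fact being derived from the half-eigen one by lit-kato's
`Kato2004.charIdeal_dvd_padicLFunctionBranch_component_of_surjective_of_half`.
[cite: Kato2004Asterisque, Thm. 17.4 (3) (p. 273)] [cite: Wuthrich2014, Thm. 3 and Cor. 19 (pp. 383, 398)] -/
theorem ClassX4Gord.branchPAdicGrossZagierOddAt_of_bsdp_of_chiBranchLowerOdd_of_katoHalf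
    (hK : Wuthrich2014.kato_halfEigenCharIdeal_dvd_cyclotomicPrime_of_surjective)
    (hmod : hasEntireLFunction_rat) (hX : ClassX4Gord W p) (hsurj : Surj W p)
    (hr : W.analyticRank = 1) (hna : ReductionNonAnomalous W p) (hbsd : BSDp W p)
    (hdiv : ChiBranchLowerDivisibilityOddAt W p) {Dh : PAdicHeightData W p}
    (hB : LeadingTermClauses W p Dh) (hS : SchneiderConjecture Dh) :
    BranchPAdicGrossZagierOddAt W p Dh :=
  hX.branchPAdicGrossZagierOddAt_of_bsdp_of_chiBranchLowerOdd_of_kato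
    (Kato2004.charIdeal_dvd_padicLFunctionBranch_component_of_surjective_of_half hK) hmod hsurj hr hna
    hbsd hdiv hB hS

omit [W.IsGloballyMinimal] in
variable {W p} in
/-- **`∀ Dh` form** (the exact converse of the hypothesis shape `hGZ` of gen 1's
`ClassX4Gord.missingLowerBoundAt_rankOne_of_chiBranchLowerOdd_of_branchPAdicGrossZagierOdd`, minus the
rider which is an input here): on X4♯(G-ord) ∩ `I₀*` ∩ {`ρ̄_{E,p}` onto}, `p ≡ 3 (mod 4)`, `r_an = 1`,
non-anomalous, `BSD(E,p)` ∧ p07's LOWER ∧ Kato ⟹ for EVERY height datum with the (B)-clauses and the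
rider, `BranchPAdicGrossZagierOddAt W p Dh`. [cite: Delbourgo2002, Theorem (B) (p. 40)] [cite: Miller2011LMS, Def. 1.1] -/
theorem ClassX4Gord.forall_branchPAdicGrossZagierOddAt_of_bsdp_of_chiBranchLowerOdd_of_kato
    (hK : Kato2004.charIdeal_dvd_padicLFunctionBranch_component_of_surjective)
    (hmod : hasEntireLFunction_rat) (hX : ClassX4Gord W p) (hsurj : Surj W p)
    (hr : W.analyticRank = 1) (hna : ReductionNonAnomalous W p) (hbsd : BSDp W p)
    (hdiv : ChiBranchLowerDivisibilityOddAt W p) :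
    ∀ Dh : PAdicHeightData W p, LeadingTermClauses W p Dh → SchneiderConjecture Dh →
      BranchPAdicGrossZagierOddAt W p Dh :=
  fun _ hB hS ↦ hX.branchPAdicGrossZagierOddAt_of_bsdp_of_chiBranchLowerOdd_of_kato hK hmod hsurj hr hna
    hbsd hdiv hB hS

end Summit.BirchSwinnertonDyer.Rank1Residual.Additive

end
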